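import Summits.BirchSwinnertonDyer.Rank1Residual.Supersingular.X7KolyvaginRoadSupersingular
import Summits.BirchSwinnertonDyer.Rank1Residual.X11b.BDPRouteHalvesClass
import Literature.NumberTheory.EllipticCurves.KolyvaginShaIndexBound
import HarnessLib

/-!
# Class X7 (good supersingular `p ≥ 5`, `E` NOT semistable), analytic rank `1`: the UPPER half of
# `BSD(E,p)` from Kolyvagin 1990 over `K` + the rank-zero LOWER bound for the Heegner twist, and the
# assembly `BSD(E,p)` ⟸ {STEP L for `E`, N5-type lower bound for `E^{d_K}`}
# (cell `bsd-ssimc`, seat `bsd-ssimc-lev`, gen 0 — companion of `X7KolyvaginRoadSupersingular.lean`, p400672)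

HONEST FRAMING (cell `bsd-ssimc`, `run/shared/lean/pub/bsd-ssimc/README.md`, row A7 = X7 = N5 / O4): THEOREMS
ONLY (no definition, no named fact, no `sorry`); nothing about any curve is asserted; nothing booked; X7
stays CONSTRUCTION-SHAPED. Memo: `HOME/bsd-ssimc-lev/MEMO-1.md` §4 (R1/R2), §11.

## What this file records

The companion file typed `ZhangKolyvaginNonvanishingSS` and proved STEP L ⇒ the LOWER half
`Typed.MissingLowerBoundAt W p` on X7 ∧ r_an = 1 ∧ p ≥ 5 ∧ surj(p). Here: the UPPER half. Jetchev–Skinner–Wan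
2017 §7.4.2, run at a good SUPERSINGULAR prime of a non-semistable curve: Kolyvagin's
`ord_p #Ш(E/K) ≤ 2·ord_p[E(K):ℤy_K]` (McCallum 1991 §1 Theorem, `ρ̄_{E,p}` onto — tree fact
`Kolyvagin1990_padicValNat_card_sha_le`, with NO hypothesis on the reduction of `E` at `p`) and the `≥`-half of
the rank-`0` `p`-part for the twist `E^{d_K}` give `ord_p #Ш(E) ≤ ord_p #Ш(E)_an` when `p ∤ ∏_ℓ c_ℓ(E)`
(`X11b.missingUpperBoundAt_of_shaIndexBound`, class-agnostic). At `p ∥ N` the twist's `≥`-half is Skinner 2016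
Thm. C; at a good supersingular prime of the NON-semistable twist `E^{d_K}` — an X7 pair of analytic rank `0`
(additive at the additive primes of `E` and at the primes of `d_K`; `a_p(E^{d_K}) = ±a_p(E) = 0`; `ρ̄` onto by
transport) — it is EXACTLY the cell's `Typed.MissingLowerBoundAt` for the twist: an N5-type input, fed on this
seat's road by the same atom as `ZhangKolyvaginNonvanishingSS` (memo §4: primitivity of the definite bipartite
system, C.-H. Kim TAMS 2024 Thm. 2.5; Burungale–Büyükboduk–Lei Adv. Math. 2024 Thm. 1.1 for the Kato direction at
any `N⁺`). So BOTH halves of O4 reduce to ONE rank-zero atom; neither the signed main conjecture EQUALITY nor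
the `p`-adic Gross–Zagier link (BKO 2024 Cor. A.5) is needed on this road.

* `ge_half_of_missingLowerBoundAt_of_analyticRank_eq_zero` — bookkeeping: `MissingLowerBoundAt` of a rank-zero
  curve in the `≥`-half shape `ord_p(L(1)/Ω) ≤ ord_p #Ш + ord_p ∏c − 2 ord_p #tors` used by the X11b/X6 chains.
* `X7.missingUpperBoundAt_of_twistLowerBound_of_kolyvagin_of_surj` — pointwise, at a Manin-unit Heegner datum.
* `X7.bsdp_of_stepL_of_twistLowerBound_of_surj` — class level: `BSD(E,p)` on X7 ∧ r_an = 1 ∧ p ≥ 5 ∧ surj(p)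
  ∧ p ∤ ∏c(E) from the two typed inputs (STEP L for `E`; N5-type lower bound for the Heegner twists of `E`),
  everything else PUBLISHED by name; field by Friedberg–Hoffstein, datum by Mazur 1978 Cor. 4.1 + Néron.

References: [JetchevSkinnerWan2017] §7.4.1–7.4.2; [McCallumLMS1991] §1; [Wuthrich2014] Prop. 21;
[Mazur1978] Cor. 4.1; [Miller2011LMS] Def. 1.1; W. Zhang 2014 Thm. 10.3 (the printed ordinary twin of the
assembly: rank-one `p`-part over ℚ from `M_∞ = 0` + the rank-zero `p`-part for the twist).
-/

noncomputable section

open scoped Classical MatrixGroups ModularForm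

open CongruenceSubgroup WeierstrassCurve NumberField Literature.NumberTheory.EllipticCurves
  Literature.NumberTheory.EllipticCurves.ModularForms
  Literature.NumberTheory.EllipticCurves.Rank1Residual
  Literature.NumberTheory.EllipticCurves.Rank1Residual.Typed
  Literature.NumberTheory.EllipticCurves.Wuthrich2014

namespace Summit.BirchSwinnertonDyer.Rank1Residual.Supersingular

section UpperHalf

/-- **Bookkeeping: the typed lower bound of a RANK-ZERO curve in the `≥`-half shape used by the
X11b/X6 chains.** For `Wd/ℚ` globally minimal with `ord_{s=1}L = 0` and `L(E_d,1) ≠ 0`,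
`Typed.MissingLowerBoundAt Wd p` (`#Ш_an = q`, `ord_p q ≤ ord_p #Ш`) gives `L(E_d,1)/Ω = t ∈ ℚ` with
`ord_p t ≤ ord_p #Ш + ord_p ∏c − 2·ord_p #tors` (`#Ш_an = t·#tors²/∏c`, `Reg = 1` by GZK). [folklore]
[cite: Miller2011LMS, §1 and Def. 1.1] -/
theorem ge_half_of_missingLowerBoundAt_of_analyticRank_eq_zero
    (hGZK : rank_eq_analyticRank_of_analyticRank_le_one)
    (Wd : WeierstrassCurve ℚ) [Wd.IsElliptic] [Wd.IsGloballyMinimal] (p : ℕ) [Fact p.Prime]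
    (hrd : Wd.analyticRank = 0) (hL1 : Wd.entireLFunction 1 ≠ 0)
    (hlow : MissingLowerBoundAt Wd p) :
    ∃ q : ℚ, Wd.entireLFunction 1 / (Wd.realPeriodRat : ℂ) = (q : ℂ) ∧
      padicValRat p q ≤ (padicValNat p Wd.shaOrder : ℤ) + padicValNat p Wd.tamagawaProduct -
        2 * padicValNat p Wd.torsionOrder := by
  obtain ⟨q, hq, hle⟩ := hlow
  have hr0 : Wd.mordellWeilRank = 0 := (hGZK Wd (by omega)).1.trans hrd
  have hReg : Wd.regulator = 1 := Wd.regulator_eq_one_of_rank_zero hr0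
  have hΩ : (Wd.realPeriodRat : ℂ) ≠ 0 := Complex.ofReal_ne_zero.mpr Wd.realPeriodRat_pos_holds.ne'
  have hT : (Wd.torsionOrder : ℚ) ≠ 0 := by exact_mod_cast Wd.torsionOrder_pos_holds.ne'
  have hc : (Wd.tamagawaProduct : ℚ) ≠ 0 := by exact_mod_cast Wd.tamagawaProduct_pos'.ne'
  have hTC : (Wd.torsionOrder : ℂ) ≠ 0 := by exact_mod_cast Wd.torsionOrder_pos_holds.ne'
  have hcC : (Wd.tamagawaProduct : ℂ) ≠ 0 := by exact_mod_cast Wd.tamagawaProduct_pos'.ne'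
  -- `L(E_d,1) · #tors² / (Ω · ∏c) = q`
  have h1 : Wd.entireLFunction 1 * (Wd.torsionOrder : ℂ) ^ 2 /
      ((Wd.realPeriodRat : ℂ) * (Wd.tamagawaProduct : ℂ)) = (q : ℂ) := by
    rw [← hq, shaAn_def, Wd.leadingLCoeff_eq_of_analyticRank_eq_zero hrd, hReg]
    push_cast
    ring
  refine ⟨q * (Wd.tamagawaProduct : ℚ) / (Wd.torsionOrder : ℚ) ^ 2, ?_, ?_⟩
  · -- `L(E_d,1)/Ω = q · ∏c / #tors²`
    push_cast
    rw [← h1]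
    field_simp
  · -- valuations
    have hq0 : q ≠ 0 := by
      intro hq0'
      apply hL1
      rw [hq0'] at h1
      have h2 : Wd.entireLFunction 1 * (Wd.torsionOrder : ℂ) ^ 2 = 0 := by
        rw [div_eq_iff (mul_ne_zero hΩ hcC)] at h1
        rw [h1]; push_cast; ring
      exact (mul_eq_zero.mp h2).resolve_right (pow_ne_zero 2 hTC)
    rw [padicValRat.div (mul_ne_zero hq0 hc) (pow_ne_zero 2 hT), padicValRat.mul hq0 hc,
      padicValRat.pow, padicValRat.of_nat, padicValRat.of_nat]
    simp only [Nat.cast_ofNat]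
    linarith

variable (W : WeierstrassCurve ℚ) [W.IsElliptic] [W.IsGloballyMinimal] (p : ℕ) [Fact p.Prime]

/-- **The UPPER half at fixed Heegner data on X7 ∧ r_an = 1 ∧ p ≥ 5 ∧ surj(p) ∧ p ∤ ∏c(E), from
Kolyvagin 1990 (`hB`, PUBLISHED) and the typed LOWER bound for the rank-zero twist (`hlowd`).** Data
as in `X7.missingLowerBoundAt_of_indexLowerBoundAt_of_surj`; `hB` = McCallum 1991 §1 Theorem
(Kolyvagin) for `(N, W, K)`; `hlowd : Typed.MissingLowerBoundAt Wd p` for the globally minimal twist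
model `Wd = Cd • E^{(d_K)}` — an X7 pair of analytic rank `0` (good supersingular at `p`, `a_p = 0`, not
semistable, `ρ̄` onto by transport), i.e. an N5-type input. CONCLUSION: `Typed.MissingUpperBoundAt W p`.
Via `X11b.missingUpperBoundAt_of_shaIndexBound` with the transports of the X6 chain
(`good_twist_model`, `X11b.padicValNat_tamagawaProduct_twist_of_heegner`,
`X11b.padicValRat_u_eq_zero_of_twist_good`) and `ge_half_of_missingLowerBoundAt_of_analyticRank_eq_zero`.
CONDITIONAL on `hlowd`; nothing booked. [cite: McCallumLMS1991, §1 Theorem (Kolyvagin), p. 296]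
[cite: JetchevSkinnerWan2017, §7.4.2 (eq:shaupper), p. 31] [cite: Miller2011LMS, Def. 1.1] -/
theorem X7.missingUpperBoundAt_of_twistLowerBound_of_kolyvagin_of_surj
    [NeZero (W.conductorNorm ℤ)] (K : Type) [Field K] [NumberField K]
    (Dt : ModularParametrizationData W (W.conductorNorm ℤ))
    (H : HeegnerDatum (W.conductorNorm ℤ) (NumberField.discr K)) (ι : K →+* ℂ)
    (P : (W.baseChange K).toAffine.Point)
    -- the published inputs (named facts of the tree)
    (hGZ : gross_zagier (W.conductorNorm ℤ) W K) (hKo : kolyvagin (W.conductorNorm ℤ) W K)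
    (hB : Kolyvagin1990_padicValNat_card_sha_le (W.conductorNorm ℤ) W K)
    (hGZK : rank_eq_analyticRank_of_analyticRank_le_one) (hmod : hasEntireLFunction_rat)
    -- the pair
    (hX : ClassX7 W p) (hs : Surj W p) (hr : W.analyticRank = 1) (hp5 : 5 ≤ p)
    (htam0 : ¬ p ∣ W.tamagawaProduct)
    -- the Heegner data
    (hK : IsImaginaryQuadratic K) (hHN : SatisfiesHeegnerHypothesis (W.conductorNorm ℤ) K)
    (hHp : SatisfiesHeegnerHypothesis p K)
    (hP : WeierstrassCurve.Affine.Point.map ι.toRatAlgHom P = heegnerPointComplex Dt H)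
    (hc : ¬ (p : ℤ) ∣ Dt.c) (hμ : ¬ p ∣ Units.torsionOrder K)
    (hLt : (W.quadraticTwist (NumberField.discr K : ℚ)).entireLFunction 1 ≠ 0)
    (Wd : WeierstrassCurve ℚ) [Wd.IsElliptic] [Wd.IsGloballyMinimal] (Cd : VariableChange ℚ)
    (hWd : Cd • W.quadraticTwist (NumberField.discr K : ℚ) = Wd)
    -- the typed input: the rank-zero LOWER bound for the twist (an X7 ∧ r_an = 0 pair)
    (hlowd : MissingLowerBoundAt Wd p) :
    MissingUpperBoundAt W p := by
  have hp : p.Prime := Fact.out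
  have hp2 : p ≠ 2 := by omega
  have hD0 : (NumberField.discr K : ℚ) ≠ 0 := by exact_mod_cast NumberField.discr_ne_zero K
  haveI hEt : (W.quadraticTwist (NumberField.discr K : ℚ)).IsElliptic :=
    W.isElliptic_quadraticTwist hD0
  have hgood : W.HasGoodReductionAtPrime p := hX.1.1
  have hpd : ¬ (p : ℤ) ∣ NumberField.discr K :=
    Literature.SatisfiesHeegnerHypothesis.not_dvd_discr hK.1 hHp hp dvd_rfl
  have hgoodd : Wd.HasGoodReductionAtPrime p := good_twist_model W p hp2 hpd hgood Cd hWd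
  have htam : padicValNat p Wd.tamagawaProduct = padicValNat p W.tamagawaProduct :=
    X11b.padicValNat_tamagawaProduct_twist_of_heegner W p hp5 K hK hHN Cd hWd
  have hu : padicValRat p (Cd.u : ℚ) = 0 :=
    X11b.padicValRat_u_eq_zero_of_twist_good W p hpd hgood Cd hWd hgoodd
  -- the twist has analytic rank `0`
  have hLt' : (W.quadraticTwist (NumberField.discr K : ℚ)).entireLFunction = Wd.entireLFunction := by
    rw [← hWd, entireLFunction_smul]
  have hLd1 : Wd.entireLFunction 1 ≠ 0 := by rw [← hLt']; exact hLt
  have hrd : Wd.analyticRank = 0 := (Wd.analyticRank_eq_zero_iff_holds (hmod Wd)).2 hLd1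
  have htw := ge_half_of_missingLowerBoundAt_of_analyticRank_eq_zero hGZK Wd p hrd hLd1 hlowd
  -- Kolyvagin's bound over `K` (`ρ̄_{E,p}` onto)
  have hU : Finite (W.baseChange K).sha → ¬ IsOfFinAddOrder P →
      padicValNat p (Nat.card (W.baseChange K).sha) ≤
        2 * padicValNat p (AddSubgroup.zmultiples P).index :=
    fun _ hnt ↦ hB hK hHN ⟨Dt, H, ι, hP⟩ hnt hp hp2 hs
  exact X11b.missingUpperBoundAt_of_shaIndexBound W p (W.conductorNorm ℤ) K Dt H ι P hGZ hKo hGZK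
    hmod hK hHN hP hp2 hc hμ hr hLt Wd Cd hWd hu htam htam0 htw hU

/-- **`BSD(E,p)` on X7 ∧ {r_an = 1} ∧ {p ≥ 5} ∧ {surj(p)} ∧ {p ∤ ∏c(E)} from the two typed inputs of
this seat's road — STEP L for `E` (`hL`, ⟸ `ZhangKolyvaginNonvanishingSS`, §2) and the rank-zero
LOWER bound for the Heegner twists of `E` (`hTw`, N5-type) —, everything else PUBLISHED by name**
(Gross–Zagier `hGZ`, Kolyvagin `hKo` and his index bound `hB`, Wuthrich 2014 Prop. 21 `hWu`, GZK
`hGZK`, modularity `hmod`/`hnf`, Friedberg–Hoffstein `hFH`, Mazur 1978 Cor. 4.1 `hMaz`, Néron `hNS`).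
The field and the Manin-unit datum are discharged as in `X7.missingLowerBoundAt_of_stepL_of_surj`;
the two halves are assembled by `X11b.bsdp_of_halves`. NO signed main conjecture, NO `p`-adic
Gross–Zagier / BKO Cor. A.5. CONDITIONAL on the two typed inputs; nothing booked; X7 unchanged.
[cite: JetchevSkinnerWan2017, §7.4.1–7.4.2 (pp. 30–31 of arXiv:1512.06894)]
[cite: McCallumLMS1991, §1 Theorem (Kolyvagin), p. 296] [cite: Wuthrich2014, Prop. 21 (p. 400)]
[cite: Mazur1978, Cor. 4.1] [cite: Miller2011LMS, §1 and Def. 1.1] -/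
theorem X7.bsdp_of_stepL_of_twistLowerBound_of_surj
    -- published inputs (named facts of the tree)
    (hGZ : ∀ (N : ℕ) [NeZero N] (W : WeierstrassCurve ℚ) (K : Type) [Field K] [NumberField K],
      gross_zagier N W K)
    (hKo : ∀ (N : ℕ) [NeZero N] (W : WeierstrassCurve ℚ) (K : Type) [Field K] [NumberField K],
      kolyvagin N W K)
    (hB : ∀ (N : ℕ) [NeZero N] (W : WeierstrassCurve ℚ) (K : Type) [Field K] [NumberField K],
      Kolyvagin1990_padicValNat_card_sha_le N W K)
    (hWu : sha_dvd_analyticSha)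
    (hGZK : rank_eq_analyticRank_of_analyticRank_le_one) (hmod : hasEntireLFunction_rat)
    (hnf : exists_isNewformOf)
    (hFH : friedbergHoffstein_exists_heegnerField_split_twist_ne_zero)
    (hMaz : mazur_not_dvd_maninConstant_of_odd) (hNS : integral_neronScaling_of_isGloballyMinimal)
    -- typed input 1: STEP L at every Manin-unit Heegner datum with `p` split in `K`
    (hL : ∀ (W : WeierstrassCurve ℚ) [W.IsElliptic] [W.IsGloballyMinimal] (p : ℕ) [Fact p.Prime]
      (N : ℕ) [NeZero N] (K : Type) [Field K] [NumberField K]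
      (Dt : ModularParametrizationData W N) (H : HeegnerDatum N (NumberField.discr K)) (ι : K →+* ℂ)
      (P : (W.baseChange K).toAffine.Point),
      ClassX7 W p → Surj W p → 5 ≤ p → W.analyticRank = 1 → W.conductorNorm ℤ = N →
      IsImaginaryQuadratic K → SatisfiesHeegnerHypothesis N K → SatisfiesHeegnerHypothesis p K →
      WeierstrassCurve.Affine.Point.map ι.toRatAlgHom P = heegnerPointComplex Dt H →
      ¬ (p : ℤ) ∣ Dt.c → X11b.IndexLowerBoundAt W p K P)
    -- typed input 2: the rank-zero LOWER bound for every Heegner twist of such a pair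
    (hTw : ∀ (W : WeierstrassCurve ℚ) [W.IsElliptic] [W.IsGloballyMinimal] (p : ℕ) [Fact p.Prime]
      (K : Type) [Field K] [NumberField K]
      (Wd : WeierstrassCurve ℚ) [Wd.IsElliptic] [Wd.IsGloballyMinimal] (Cd : VariableChange ℚ),
      ClassX7 W p → Surj W p → 5 ≤ p → W.analyticRank = 1 → IsImaginaryQuadratic K →
      SatisfiesHeegnerHypothesis (W.conductorNorm ℤ) K → SatisfiesHeegnerHypothesis p K →
      (W.quadraticTwist (NumberField.discr K : ℚ)).entireLFunction 1 ≠ 0 →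
      Cd • W.quadraticTwist (NumberField.discr K : ℚ) = Wd → MissingLowerBoundAt Wd p) :
    ∀ (W : WeierstrassCurve ℚ) [W.IsElliptic] [W.IsGloballyMinimal] (p : ℕ) [Fact p.Prime],
      ClassX7 W p → Surj W p → 5 ≤ p → W.analyticRank = 1 → ¬ p ∣ W.tamagawaProduct →
      BSDp W p := by
  intro W _ _ p _ hX hs hp5 hr htam0
  have hp : p.Prime := Fact.out
  have hp2 : p ≠ 2 := by omega
  have hgood : W.HasGoodReductionAtPrime p := hX.1.1
  have hirr : Irr W p := ClassX7.irr W p hp2 hX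
  haveI : NeZero (W.conductorNorm ℤ) := ⟨(W.conductorNorm_pos_holds).ne'⟩
  -- the sign of the functional equation is `−1` (modularity, `r_an = 1`)
  have hw : W.rootNumber = -1 := by
    rw [WeierstrassCurve.rootNumber_eq_neg_one_pow_analyticRank_of_exists_isNewformOf hnf W, hr]
    norm_num
  -- the auxiliary field (Friedberg–Hoffstein)
  obtain ⟨K, _, _, hK, hdisc, hHN, hHp, hLt⟩ := hFH W hw p hp 4
  have hμ : ¬ p ∣ Units.torsionOrder K := by
    haveI : IsTotallyComplex K := hK.2
    have hneg : NumberField.discr K < 0 := discr_neg_of_finrank_eq_two K hK.1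
    have habs : ((NumberField.discr K).natAbs : ℤ) = -NumberField.discr K :=
      Int.ofNat_natAbs_of_nonpos hneg.le
    have h4 : NumberField.discr K < -4 := by
      have : (4 : ℤ) < ((NumberField.discr K).natAbs : ℤ) := by exact_mod_cast hdisc
      omega
    rw [Literature.NumberTheory.DiophantineGeometry.torsionOrder_eq_two_of_discr_lt hK.1 h4]
    intro h2
    have := Nat.le_of_dvd two_pos h2
    omega
  -- the Manin-unit Heegner datum at a good odd prime
  obtain ⟨Dt, H, ι, P, hP, hc⟩ :=
    X11b.exists_maninDatum_of_good hnf hMaz hNS W p (W.conductorNorm ℤ) K rfl hp2 hgood hirr hK hHN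
  -- a globally minimal model of the twist
  have hD0 : (NumberField.discr K : ℚ) ≠ 0 := by exact_mod_cast NumberField.discr_ne_zero K
  haveI hEt : (W.quadraticTwist (NumberField.discr K : ℚ)).IsElliptic :=
    W.isElliptic_quadraticTwist hD0
  obtain ⟨Cd, hCd⟩ := hasGlobalMinimalModel_rat_holds (W.quadraticTwist (NumberField.discr K : ℚ))
  haveI : (Cd • W.quadraticTwist (NumberField.discr K : ℚ)).IsGloballyMinimal := hCd
  have hWd : Cd • W.quadraticTwist (NumberField.discr K : ℚ) =
      Cd • W.quadraticTwist (NumberField.discr K : ℚ) := rfl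
  have hlow : MissingLowerBoundAt W p :=
    X7.missingLowerBoundAt_of_indexLowerBoundAt_of_surj W p K Dt H ι P (hGZ _ W K) (hKo _ W K)
      hWu hGZK hmod hX hs hr hp5 hK hHN hHp hP hc hμ hLt
      (Cd • W.quadraticTwist (NumberField.discr K : ℚ)) Cd hWd
      (hL W p _ K Dt H ι P hX hs hp5 hr rfl hK hHN hHp hP hc)
  have hup : MissingUpperBoundAt W p :=
    X7.missingUpperBoundAt_of_twistLowerBound_of_kolyvagin_of_surj W p K Dt H ι P (hGZ _ W K)
      (hKo _ W K) (hB _ W K) hGZK hmod hX hs hr hp5 htam0 hK hHN hHp hP hc hμ hLt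
      (Cd • W.quadraticTwist (NumberField.discr K : ℚ)) Cd hWd
      (hTw W p K (Cd • W.quadraticTwist (NumberField.discr K : ℚ)) Cd hX hs hp5 hr hK hHN hHp hLt hWd)
  exact X11b.bsdp_of_halves hGZK W p (by omega) hlow hup

end UpperHalf


end Summit.BirchSwinnertonDyer.Rank1Residual.Supersingular

end
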